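import Mathlib.Data.Finset.Powerset
import Mathlib.Data.Nat.Choose.Bounds
import Mathlib.Algebra.Order.BigOperators.Group.Finset
import Mathlib.Analysis.SpecialFunctions.Pow.Real

/-!
# Route FeketeSOS — crux `FeketeSOSHard` (stmt-ValiantsHypothesis-3996), line `paley-rip` (v3),
# stub `stub_paleyFlatRIP`: counting lemmas for averaging over supports of a fixed size

Second of three files behind `…PaleyRIPRandomSupport.lean` (the engine holds for almost all supports):
elementary bookkeeping for the uniform measure on `m`-subsets `S ⊆ U`.

* `sum_powersetCard_quad` — `Σ_{#S=m} Σ_{a,b,c,d∈S} g = Σ_{a,b,c,d∈U} #{S : a,b,c,d ∈ S}·g`;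
* `card_powersetCard_supset` — `#{S ⊆ U : #S = m, T ⊆ S} = C(#U − #T, m − #T)` (`S ↦ S \ T`);
  `card_powersetCard_mem_four` — for pairwise distinct `a,b,c,d` this is `C(#U − 4, m − 4)`;
* `quad_noninj_le` — at most `6(#S)³` of the 4-tuples from `S` have a repeated entry;
* `choose_sub_four_le` — `C(p−4, m−4) ≤ 384·(m/p)⁴·C(p,m)` (`m ≥ 4`, `p ≥ 6`).

Honest framing: combinatorics only; nothing here is about the engine, which stays OPEN; `VP ≠ VNP` untouched.
-/

set_option linter.dupNamespace false

namespace Summit.ValiantsHypothesis.ValiantsHypothesis.Theorems.FeketeSOSHardPaleyRIP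

open Finset
open scoped BigOperators

noncomputable section

/-! ## Averaging over the supports of a given size -/

section Counting

/-- **Exchange of summations**: a fourfold sum over `S`, summed over all `m`-subsets `S` of `U`, is the
fourfold sum over `U` weighted by the number of `m`-subsets containing the four indices. [folklore] -/
theorem sum_powersetCard_quad {R : Type*} [CommRing R] (U : Finset ℕ) (m : ℕ)
    (g : ℕ → ℕ → ℕ → ℕ → R) :
    ∑ S ∈ powersetCard m U, ∑ a ∈ S, ∑ b ∈ S, ∑ c ∈ S, ∑ d ∈ S, g a b c d =
      ∑ a ∈ U, ∑ b ∈ U, ∑ c ∈ U, ∑ d ∈ U,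
        (((powersetCard m U).filter (fun S => a ∈ S ∧ b ∈ S ∧ c ∈ S ∧ d ∈ S)).card : R) *
          g a b c d := by
  classical
  -- restrict-to-`S` as an indicator over `U`
  have hind : ∀ S ∈ powersetCard m U, ∀ (F : ℕ → R),
      ∑ a ∈ S, F a = ∑ a ∈ U, if a ∈ S then F a else 0 := by
    intro S hS F
    rw [← Finset.sum_filter, Finset.filter_mem_eq_inter,
      inter_eq_right.2 (mem_powersetCard.1 hS).1]
  have hS4 : ∀ S ∈ powersetCard m U, ∑ a ∈ S, ∑ b ∈ S, ∑ c ∈ S, ∑ d ∈ S, g a b c d =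
      ∑ a ∈ U, ∑ b ∈ U, ∑ c ∈ U, ∑ d ∈ U,
        if (a ∈ S ∧ b ∈ S ∧ c ∈ S ∧ d ∈ S) then g a b c d else 0 := by
    intro S hS
    rw [hind S hS]
    refine Finset.sum_congr rfl fun a _ => ?_
    by_cases ha : a ∈ S
    · rw [if_pos ha, hind S hS]
      refine Finset.sum_congr rfl fun b _ => ?_
      by_cases hb : b ∈ S
      · rw [if_pos hb, hind S hS]
        refine Finset.sum_congr rfl fun c _ => ?_
        by_cases hc : c ∈ S
        · rw [if_pos hc, hind S hS]
          refine Finset.sum_congr rfl fun d _ => ?_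
          by_cases hd : d ∈ S
          · rw [if_pos hd, if_pos ⟨ha, hb, hc, hd⟩]
          · rw [if_neg hd, if_neg (fun h => hd h.2.2.2)]
        · rw [if_neg hc]; symm
          exact Finset.sum_eq_zero fun d _ => if_neg (fun h => hc h.2.2.1)
      · rw [if_neg hb]; symm
        exact Finset.sum_eq_zero fun c _ => Finset.sum_eq_zero fun d _ => if_neg (fun h => hb h.2.1)
    · rw [if_neg ha]; symm
      exact Finset.sum_eq_zero fun b _ => Finset.sum_eq_zero fun c _ =>
        Finset.sum_eq_zero fun d _ => if_neg (fun h => ha h.1)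
  rw [Finset.sum_congr rfl hS4, Finset.sum_comm]
  refine Finset.sum_congr rfl fun a _ => ?_
  rw [Finset.sum_comm]
  refine Finset.sum_congr rfl fun b _ => ?_
  rw [Finset.sum_comm]
  refine Finset.sum_congr rfl fun c _ => ?_
  rw [Finset.sum_comm]
  refine Finset.sum_congr rfl fun d _ => ?_
  rw [← Finset.sum_filter, Finset.sum_const, nsmul_eq_mul]

/-- **Supersets of a fixed set among the `m`-subsets**: for `T ⊆ U` with `#T ≤ m`,
`#{S ⊆ U : #S = m, T ⊆ S} = C(#U − #T, m − #T)` (`S ↦ S \ T`). [folklore] -/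
theorem card_powersetCard_supset (U T : Finset ℕ) (hTU : T ⊆ U) (m : ℕ) (hTm : T.card ≤ m) :
    ((powersetCard m U).filter (fun S => T ⊆ S)).card = (U.card - T.card).choose (m - T.card) := by
  classical
  rw [← Finset.card_sdiff_of_subset hTU, ← Finset.card_powersetCard]
  refine Finset.card_nbij' (fun S => S \ T) (fun R => R ∪ T) ?_ ?_ ?_ ?_
  · intro S hS
    rw [Finset.mem_coe, Finset.mem_filter, Finset.mem_powersetCard] at hS
    rw [Finset.mem_coe, Finset.mem_powersetCard]
    exact ⟨sdiff_subset_sdiff hS.1.1 le_rfl, by rw [Finset.card_sdiff_of_subset hS.2, hS.1.2]⟩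
  · intro R hR
    rw [Finset.mem_coe, Finset.mem_powersetCard] at hR
    rw [Finset.mem_coe, Finset.mem_filter, Finset.mem_powersetCard]
    have hdisj : Disjoint R T := by
      have : R ⊆ U \ T := hR.1
      exact Finset.disjoint_of_subset_left this Finset.sdiff_disjoint
    refine ⟨⟨Finset.union_subset (hR.1.trans Finset.sdiff_subset) hTU, ?_⟩, Finset.subset_union_right⟩
    rw [Finset.card_union_of_disjoint hdisj, hR.2]; omega
  · intro S hS
    rw [Finset.mem_coe, Finset.mem_filter] at hS
    exact Finset.sdiff_union_of_subset hS.2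
  · intro R hR
    rw [Finset.mem_coe, Finset.mem_powersetCard] at hR
    have hdisj : Disjoint R T := Finset.disjoint_of_subset_left hR.1 Finset.sdiff_disjoint
    show (R ∪ T) \ T = R
    rw [Finset.union_sdiff_right, Finset.sdiff_eq_self_iff_disjoint]
    exact hdisj

/-- Four pairwise distinct naturals form a set of size `4`. [folklore] -/
theorem card_quad_eq_four {a b c d : ℕ} (hab : a ≠ b) (hac : a ≠ c) (had : a ≠ d) (hbc : b ≠ c)
    (hbd : b ≠ d) (hcd : c ≠ d) : ({a, b, c, d} : Finset ℕ).card = 4 := by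
  rw [Finset.card_insert_of_notMem (by simp [hab, hac, had]),
    Finset.card_insert_of_notMem (by simp [hbc, hbd]),
    Finset.card_insert_of_notMem (by simp [hcd]), Finset.card_singleton]

/-- For pairwise distinct `a, b, c, d ∈ U` and `m ≥ 4`, exactly `C(#U − 4, m − 4)` of the `m`-subsets of `U`
contain all four. [folklore] -/
theorem card_powersetCard_mem_four (U : Finset ℕ) (m : ℕ) (hm : 4 ≤ m) {a b c d : ℕ}
    (ha : a ∈ U) (hb : b ∈ U) (hc : c ∈ U) (hd : d ∈ U)
    (hab : a ≠ b) (hac : a ≠ c) (had : a ≠ d) (hbc : b ≠ c) (hbd : b ≠ d) (hcd : c ≠ d) :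
    ((powersetCard m U).filter (fun S => a ∈ S ∧ b ∈ S ∧ c ∈ S ∧ d ∈ S)).card =
      (U.card - 4).choose (m - 4) := by
  classical
  have hT : ({a, b, c, d} : Finset ℕ) ⊆ U := by
    intro x hx
    simp only [Finset.mem_insert, Finset.mem_singleton] at hx
    rcases hx with rfl | rfl | rfl | rfl <;> assumption
  have h4 := card_quad_eq_four hab hac had hbc hbd hcd
  have h := card_powersetCard_supset U {a, b, c, d} hT m (by rw [h4]; exact hm)
  rw [h4] at h
  rw [← h]
  congr 1
  refine Finset.filter_congr fun S _ => ?_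
  simp only [Finset.insert_subset_iff, Finset.singleton_subset_iff]

/-- **Few non-injective 4-tuples**: at most `6·(#S)³` of the 4-tuples from `S` have a repeated entry.
[folklore] -/
theorem quad_noninj_le (S : Finset ℕ) :
    (∑ a ∈ S, ∑ b ∈ S, ∑ c ∈ S, ∑ d ∈ S,
      if (a = b ∨ a = c ∨ a = d ∨ b = c ∨ b = d ∨ c = d) then (1 : ℝ) else 0) ≤
      6 * (S.card : ℝ) ^ 3 := by
  classical
  -- pointwise union bound over the six coincidences
  have h0 : ∀ (Q : Prop) [Decidable Q], (0 : ℝ) ≤ (if Q then (1 : ℝ) else 0) := by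
    intro Q _; split_ifs <;> norm_num
  have hpt : ∀ a b c d : ℕ,
      (if (a = b ∨ a = c ∨ a = d ∨ b = c ∨ b = d ∨ c = d) then (1 : ℝ) else 0) ≤
      (if a = b then 1 else 0) + (if a = c then 1 else 0) + (if a = d then 1 else 0) +
      (if b = c then 1 else 0) + (if b = d then 1 else 0) + (if c = d then (1 : ℝ) else 0) := by
    intro a b c d
    have n1 := h0 (a = b); have n2 := h0 (a = c); have n3 := h0 (a = d)
    have n4 := h0 (b = c); have n5 := h0 (b = d); have n6 := h0 (c = d)
    by_cases h : (a = b ∨ a = c ∨ a = d ∨ b = c ∨ b = d ∨ c = d)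
    · rw [if_pos h]
      rcases h with h | h | h | h | h | h
      · have : (if a = b then (1 : ℝ) else 0) = 1 := if_pos h
        linarith
      · have : (if a = c then (1 : ℝ) else 0) = 1 := if_pos h
        linarith
      · have : (if a = d then (1 : ℝ) else 0) = 1 := if_pos h
        linarith
      · have : (if b = c then (1 : ℝ) else 0) = 1 := if_pos h
        linarith
      · have : (if b = d then (1 : ℝ) else 0) = 1 := if_pos h
        linarith
      · have : (if c = d then (1 : ℝ) else 0) = 1 := if_pos h
        linarith
    · rw [if_neg h]; linarith
  have m3 : ((S.card : ℝ)) ^ 3 = ∑ a ∈ S, ∑ b ∈ S, ∑ c ∈ S, (1 : ℝ) := by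
    simp [Finset.sum_const]; ring
  -- each coincidence sum equals `(#S)³`
  have e1 : ∑ a ∈ S, ∑ b ∈ S, ∑ c ∈ S, ∑ d ∈ S, (if a = b then (1 : ℝ) else 0) = (S.card : ℝ) ^ 3 := by
    rw [m3]
    refine Finset.sum_congr rfl fun a ha => ?_
    rw [Finset.sum_comm]
    refine Finset.sum_congr rfl fun c _ => ?_
    rw [Finset.sum_comm]
    rw [Finset.sum_congr rfl fun d _ => Finset.sum_ite_eq S a (fun _ => (1 : ℝ))]
    simp [ha]
  have e2 : ∑ a ∈ S, ∑ b ∈ S, ∑ c ∈ S, ∑ d ∈ S, (if a = c then (1 : ℝ) else 0) = (S.card : ℝ) ^ 3 := by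
    rw [m3]
    refine Finset.sum_congr rfl fun a ha => Finset.sum_congr rfl fun b _ => ?_
    rw [Finset.sum_comm, Finset.sum_congr rfl fun d _ => Finset.sum_ite_eq S a (fun _ => (1 : ℝ))]
    simp [ha]
  have e3 : ∑ a ∈ S, ∑ b ∈ S, ∑ c ∈ S, ∑ d ∈ S, (if a = d then (1 : ℝ) else 0) = (S.card : ℝ) ^ 3 := by
    rw [m3]
    refine Finset.sum_congr rfl fun a ha => Finset.sum_congr rfl fun b _ =>
      Finset.sum_congr rfl fun c _ => ?_
    rw [Finset.sum_ite_eq S a (fun _ => (1 : ℝ)), if_pos ha]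
  have e4 : ∑ a ∈ S, ∑ b ∈ S, ∑ c ∈ S, ∑ d ∈ S, (if b = c then (1 : ℝ) else 0) = (S.card : ℝ) ^ 3 := by
    rw [m3]
    refine Finset.sum_congr rfl fun a _ => Finset.sum_congr rfl fun b hb => ?_
    rw [Finset.sum_comm, Finset.sum_congr rfl fun d _ => Finset.sum_ite_eq S b (fun _ => (1 : ℝ))]
    simp [hb]
  have e5 : ∑ a ∈ S, ∑ b ∈ S, ∑ c ∈ S, ∑ d ∈ S, (if b = d then (1 : ℝ) else 0) = (S.card : ℝ) ^ 3 := by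
    rw [m3]
    refine Finset.sum_congr rfl fun a _ => Finset.sum_congr rfl fun b hb =>
      Finset.sum_congr rfl fun c _ => ?_
    rw [Finset.sum_ite_eq S b (fun _ => (1 : ℝ)), if_pos hb]
  have e6 : ∑ a ∈ S, ∑ b ∈ S, ∑ c ∈ S, ∑ d ∈ S, (if c = d then (1 : ℝ) else 0) = (S.card : ℝ) ^ 3 := by
    rw [m3]
    refine Finset.sum_congr rfl fun a _ => Finset.sum_congr rfl fun b _ =>
      Finset.sum_congr rfl fun c hc => ?_
    rw [Finset.sum_ite_eq S c (fun _ => (1 : ℝ)), if_pos hc]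
  calc (∑ a ∈ S, ∑ b ∈ S, ∑ c ∈ S, ∑ d ∈ S,
        if (a = b ∨ a = c ∨ a = d ∨ b = c ∨ b = d ∨ c = d) then (1 : ℝ) else 0)
      ≤ ∑ a ∈ S, ∑ b ∈ S, ∑ c ∈ S, ∑ d ∈ S,
          ((if a = b then 1 else 0) + (if a = c then 1 else 0) + (if a = d then 1 else 0) +
          (if b = c then 1 else 0) + (if b = d then 1 else 0) + (if c = d then (1 : ℝ) else 0)) :=
        Finset.sum_le_sum fun a _ => Finset.sum_le_sum fun b _ => Finset.sum_le_sum fun c _ =>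
          Finset.sum_le_sum fun d _ => hpt a b c d
    _ = 6 * (S.card : ℝ) ^ 3 := by
        simp only [Finset.sum_add_distrib]
        rw [e1, e2, e3, e4, e5, e6]; ring

end Counting

section Binomial

/-- `C(p−4, m−4) ≤ 384·m⁴/p⁴·C(p, m)` for `4 ≤ m`, `p ≥ 6` (from `C(p,m)C(m,4) = C(p,4)C(p−4,m−4)`).
[folklore] -/
theorem choose_sub_four_le (p m : ℕ) (hm : 4 ≤ m) (hp : 6 ≤ p) :
    (((p - 4).choose (m - 4) : ℕ) : ℝ) ≤ 384 * ((m : ℝ) ^ 4 / (p : ℝ) ^ 4) * ((p.choose m : ℕ) : ℝ) := by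
  have hid : (p.choose m : ℝ) * (m.choose 4 : ℝ) = (p.choose 4 : ℝ) * ((p - 4).choose (m - 4) : ℝ) := by
    exact_mod_cast Nat.choose_mul hm
  -- `C(m,4) ≤ m⁴` and `24·C(p,4) ≥ (p−3)⁴ ≥ p⁴/16`
  have hm4 : (m.choose 4 : ℝ) ≤ (m : ℝ) ^ 4 := by exact_mod_cast Nat.choose_le_pow m 4
  have hdesc : ((p - 3 : ℕ) : ℝ) ^ 4 ≤ 24 * (p.choose 4 : ℝ) := by
    have h1 : (p + 1 - 4) ^ 4 ≤ p.descFactorial 4 := Nat.pow_sub_le_descFactorial p 4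
    rw [Nat.descFactorial_eq_factorial_mul_choose] at h1
    have h2 : p + 1 - 4 = p - 3 := by omega
    rw [h2] at h1
    have h3 : (4 : ℕ).factorial = 24 := by decide
    rw [h3] at h1
    exact_mod_cast h1
  have hp3 : (p : ℝ) / 2 ≤ ((p - 3 : ℕ) : ℝ) := by
    rw [Nat.cast_sub (by omega)]
    have : (6 : ℝ) ≤ (p : ℝ) := by exact_mod_cast hp
    push_cast; linarith
  have hp0 : (0 : ℝ) < (p : ℝ) := by exact_mod_cast (show 0 < p by omega)
  have hC4 : (p : ℝ) ^ 4 / 384 ≤ (p.choose 4 : ℝ) := by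
    have : ((p : ℝ) / 2) ^ 4 ≤ ((p - 3 : ℕ) : ℝ) ^ 4 := pow_le_pow_left₀ (by positivity) hp3 4
    have h' : ((p : ℝ) / 2) ^ 4 = (p : ℝ) ^ 4 / 16 := by ring
    rw [h'] at this
    linarith
  have hC4pos : (0 : ℝ) < (p.choose 4 : ℝ) := lt_of_lt_of_le (by positivity) hC4
  -- `X = C(p,m) C(m,4) / C(p,4) ≤ C(p,m) m⁴ · 384/p⁴`
  have hX : (((p - 4).choose (m - 4) : ℕ) : ℝ) = (p.choose m : ℝ) * (m.choose 4 : ℝ) / (p.choose 4 : ℝ) := by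
    rw [hid]; field_simp
  rw [hX, div_le_iff₀ hC4pos]
  have hCm0 : (0 : ℝ) ≤ (p.choose m : ℝ) := Nat.cast_nonneg _
  calc (p.choose m : ℝ) * (m.choose 4 : ℝ) ≤ (p.choose m : ℝ) * (m : ℝ) ^ 4 :=
        mul_le_mul_of_nonneg_left hm4 hCm0
    _ = 384 * ((m : ℝ) ^ 4 / (p : ℝ) ^ 4) * (p.choose m : ℝ) * ((p : ℝ) ^ 4 / 384) := by
        field_simp
    _ ≤ 384 * ((m : ℝ) ^ 4 / (p : ℝ) ^ 4) * (p.choose m : ℝ) * (p.choose 4 : ℝ) :=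
        mul_le_mul_of_nonneg_left hC4 (by positivity)

end Binomial

end

end Summit.ValiantsHypothesis.ValiantsHypothesis.Theorems.FeketeSOSHardPaleyRIP
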